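import Mathlib
import HarnessLib
import Summits.QuantumFields.YangMills.Theorems.PencilRigidityCurvatureKernelBoundSwapHankelLogConvex
import Summits.QuantumFields.YangMills.Theorems.PencilRigidityCurvatureKernelBoundLogConvexExpDecay
import Summits.QuantumFields.YangMills.Theorems.PencilRigidityCurvatureKernelBoundSmearedSwapObservables
import Literature.MathematicalPhysics.QuantumFieldTheory.StrongCouplingInfiniteVolume

/-!
# `CurvatureKernelBound` — brick `SwapHankelDecay` of lead c10's swap-mirror programme toward `Stub.FiniteCouplingStrongSubextensive`
# (crux stmt-QuantumFields-11687, line `coupling-trichotomy`, skeleton v9, wave 3)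

**Exponential decay of the swap-Hankel sequence of the smeared curvature at a fixed lattice.**
Spacing `a > 0`, box `Λ_L = {-L,…,L}⁴`, coupling `0 ≤ β ≤ β' < β₁/4`, pencil `v = e₀ - e₁`, mirror
`θ = swap 0 1`; `q β`, `P β z` the infinite-volume one- and two-point data of the curvature `Q` with
clustering `|P β z - q β²| ≤ A e^{-m‖z‖_∞}` (conclusion of `InfiniteVolumeCurvatureClustering`, a
hypothesis here).  For `g` supported in `{z₀ - z₁ ≥ δ}`, `a ≤ δ`, and `gθ = g ∘ θ`, the sequence
`E u = a⁸ ∑_{x,y ∈ Λ_L} g(a x) gθ(a y) (P β (y - x - 2u v) - q β²)` satisfies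
`0 ≤ E u ≤ E 0 · e^{-2mu}` for all `u : ℕ`.
Proof: with `X = a⁴ ∑_x g(a x) Q ∘ τ_x` (bounded, measurable, positive links:
`SmearedPositiveHalfSupport`) the three box limits of `SwapHankelLogConvex` are finite-sum limit
algebra over the hypotheses (`X ∘ Θ` is the field smeared against `gθ`: `SmearedCurvatureSwapCovariance`;
`∑_{Λ_L} gθ = ∑_{Λ_L} g`), so swap reflection positivity (`SwapReflectionPositivity`) makes
`E u = P^X(2u) - x̄²` non-negative and log-convex; clustering and `‖y - x - 2Uv‖_∞ ≥ 2U - 2L` give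
`E U ≤ K e^{-2mU}` for all `U`, and `LogConvexExpDecay` transports the rate to every `u`. [folklore]
-/

noncomputable section

open scoped BigOperators Topology SchwartzMap
open MeasureTheory Filter Set
open Literature.MathematicalPhysics.QuantumLattice Literature.MathematicalPhysics.QuantumFieldTheory
  Literature.Probability.LatticeModels

namespace Summit.QuantumFields.YangMills.Theorems.CurvatureKernel

namespace SwapDecay

/-- The swapped test function `gθ = g ∘ θ` evaluated on the rescaled lattice: `gθ (a y) = g (a (y ∘ swap 0 1))`
(`siteToE` is coordinatewise). [folklore] -/
theorem swapTest_apply_smul_siteToE (a : ℝ) (g gθ : 𝓢(EuclideanSpace ℝ (Fin 4), ℝ))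
    (hgθ : ∀ z : EuclideanSpace ℝ (Fin 4),
      gθ z = g (WithLp.toLp 2 (fun i => z (Equiv.swap (0 : Fin 4) 1 i))))
    (y : Site 4) : gθ (a • siteToE y) = g (a • siteToE (y ∘ ⇑(Equiv.swap (0 : Fin 4) 1))) := by
  rw [hgθ]
  rfl

/-- A sum over the swap-symmetric box `{-L,…,L}⁴` is invariant under reindexing by the coordinate
swap `y ↦ y ∘ swap i j`. [folklore] -/
theorem sum_box_comp_swap {M : Type*} [AddCommMonoid M] (i j : Fin 4) (L : ℕ) (φ : Site 4 → M) :
    ∑ y ∈ box 4 L, φ (y ∘ ⇑(Equiv.swap i j)) = ∑ y ∈ box 4 L, φ y :=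
  Finset.sum_nbij' (fun x => x ∘ ⇑(Equiv.swap i j)) (fun x => x ∘ ⇑(Equiv.swap i j))
    (fun _ hx => comp_swap_mem_box i j hx) (fun _ hx => comp_swap_mem_box i j hx)
    (fun x _ => comp_swap_comp_swap i j x) (fun x _ => comp_swap_comp_swap i j x) (fun _ _ => rfl)

/-- `τₓ ∘ τ_w = τ_{x + w}`: `configShift (-x) (translate w U) = translate (x + w) U`. [folklore] -/
theorem configShift_neg_translate {G : Type*} [MeasurableSpace G] (x w : Site 4)
    (U : ZdGaugeConfig 4 G) :
    Literature.MathematicalPhysics.QuantumLattice.configShift (-x) (ZdGaugeConfig.translate w U) =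
      ZdGaugeConfig.translate (x + w) U := by
  funext e
  simp only [Literature.MathematicalPhysics.QuantumLattice.configShift_apply, ZdGaugeConfig.translate,
    sub_neg_eq_add, add_assoc]

/-- Far along the pencil the displacement is large: for `x, y ∈ {-L,…,L}⁴`,
`‖y - x - 2U (e₀ - e₁)‖_∞ ≥ 2U - 2L` (look at coordinate `0`). [folklore] -/
theorem norm_far_bound (L U : ℕ) {x y : Site 4} (hx : x ∈ box 4 L) (hy : y ∈ box 4 L) :
    (2 * U : ℝ) - 2 * L ≤
      ‖y - x - ((2 * U : ℕ) : ℤ) • (Pi.single 0 (1 : ℤ) - Pi.single 1 (1 : ℤ) : Site 4)‖ := by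
  set z : Site 4 := y - x - ((2 * U : ℕ) : ℤ) • (Pi.single 0 (1 : ℤ) - Pi.single 1 (1 : ℤ) : Site 4)
    with hz
  have h0 : ‖z 0‖ ≤ ‖z‖ := norm_le_pi_norm z 0
  rw [Int.norm_eq_abs] at h0
  have hz0 : z 0 = y 0 - x 0 - 2 * U := by
    simp [hz]
  have h1 : ((x 0 : ℤ) : ℝ) ≥ -L := by exact_mod_cast (mem_box.1 hx 0).1
  have h2 : ((y 0 : ℤ) : ℝ) ≤ L := by exact_mod_cast (mem_box.1 hy 0).2
  refine LE.le.trans ?_ h0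
  rw [hz0]
  push_cast
  linarith [neg_abs_le (((y 0 : ℤ) : ℝ) - x 0 - 2 * U)]

section Expect

variable {G : Type*} [Group G] [TopologicalSpace G] [IsTopologicalGroup G] [CompactSpace G]
  [MeasurableSpace G] [BorelSpace G] {N : ℕ}

/-- A bounded measurable observable is integrable for the free-boundary state `μ_{Λ,β}` (a
probability measure, or the zero measure for a degenerate normalisation). [folklore] -/
theorem integrable_zdWilsonMeasure_of_bounded (ρ : G →* Matrix (Fin N) (Fin N) ℂ) (β : ℝ)
    (Λ : Finset (Site 4)) {f : ZdGaugeConfig 4 G → ℝ} (hf : Measurable f) {C : ℝ}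
    (hC : ∀ U, |f U| ≤ C) : Integrable f (zdWilsonMeasure (d := 4) ρ β Λ) := by
  rcases zdWilsonMeasure_eq_zero_or_isProbabilityMeasure ρ β Λ with h0 | hprob
  · rw [h0]; exact integrable_zero_measure
  · exact Integrable.of_bound hf.aestronglyMeasurable C (ae_of_all _ fun U => by
      rw [Real.norm_eq_abs]; exact hC U)

/-- Linearity of `⟨·⟩_{Λ,β}` on a weighted finite sum of bounded measurable observables. [folklore] -/
theorem zdExpect_const_mul_sum (ρ : G →* Matrix (Fin N) (Fin N) ℂ) (β : ℝ) (Λ : Finset (Site 4))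
    (s : Finset (Site 4)) (c : ℝ) (w : Site 4 → ℝ) (f : Site 4 → ZdGaugeConfig 4 G → ℝ)
    (hfm : ∀ x, Measurable (f x)) (hfb : ∀ x, ∃ C : ℝ, ∀ U, |f x U| ≤ C) :
    zdExpect ρ β Λ (fun U => c * ∑ x ∈ s, w x * f x U) =
      c * ∑ x ∈ s, w x * zdExpect ρ β Λ (f x) := by
  have hI : ∀ x, Integrable (f x) (zdWilsonMeasure (d := 4) ρ β Λ) := fun x =>
    (hfb x).elim fun C hC => integrable_zdWilsonMeasure_of_bounded ρ β Λ (hfm x) hC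
  unfold zdExpect
  rw [integral_const_mul, integral_finsetSum _ (fun x _ => (hI x).const_mul _)]
  congr 1
  exact Finset.sum_congr rfl fun x _ => integral_const_mul _ _

/-- Linearity of `⟨·⟩_{Λ,β}` on a weighted finite double sum of bounded measurable observables. [folklore] -/
theorem zdExpect_const_mul_sum₂ (ρ : G →* Matrix (Fin N) (Fin N) ℂ) (β : ℝ) (Λ : Finset (Site 4))
    (s t : Finset (Site 4)) (c : ℝ) (w : Site 4 → Site 4 → ℝ)
    (f : Site 4 → Site 4 → ZdGaugeConfig 4 G → ℝ)
    (hfm : ∀ x y, Measurable (f x y)) (hfb : ∀ x y, ∃ C : ℝ, ∀ U, |f x y U| ≤ C) :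
    zdExpect ρ β Λ (fun U => c * ∑ x ∈ s, ∑ y ∈ t, w x y * f x y U) =
      c * ∑ x ∈ s, ∑ y ∈ t, w x y * zdExpect ρ β Λ (f x y) := by
  have hI : ∀ x y, Integrable (f x y) (zdWilsonMeasure (d := 4) ρ β Λ) := fun x y =>
    (hfb x y).elim fun C hC => integrable_zdWilsonMeasure_of_bounded ρ β Λ (hfm x y) hC
  unfold zdExpect
  rw [integral_const_mul, integral_finsetSum _ (fun x _ =>
    integrable_finsetSum _ fun y _ => (hI x y).const_mul _)]
  congr 1
  refine Finset.sum_congr rfl fun x _ => ?_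
  rw [integral_finsetSum _ (fun y _ => (hI x y).const_mul _)]
  exact Finset.sum_congr rfl fun y _ => integral_const_mul _ _

end Expect

section Limits

variable {G : Type} [Group G] [TopologicalSpace G] [IsTopologicalGroup G] [CompactSpace G]
  [MeasurableSpace G] [BorelSpace G]

/-- The smeared curvature of a translated configuration, unfolded:
`X (τ_w U) = a⁴ ∑ₓ g(a x) Q(τ_{x + w} U)`. [folklore] -/
theorem smeared_translate_apply (r : LatticeRep G) (L : ℕ) (a : ℝ)
    (g : 𝓢(EuclideanSpace ℝ (Fin 4), ℝ)) (w : Site 4) (U : ZdGaugeConfig 4 G) :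
    smearedLatticeField r.curvature.F (box 4 L) a 1 0 g (ZdGaugeConfig.translate w U) =
      a ^ 4 * ∑ x ∈ box 4 L, g (a • siteToE x) *
        r.curvature.F (ZdGaugeConfig.translate (x + w) U) := by
  rw [SwapRP.smearedLatticeField_one_zero]
  simp only [configShift_neg_translate]

/-- The smeared curvature of the swap-mirrored translated configuration, unfolded with the swapped
test function: `X (Θ (τ_w U)) = a⁴ ∑_y gθ(a y) Q(τ_{y + w} U)`. [folklore] -/
theorem smeared_swap_translate_apply (r : LatticeRep G) (L : ℕ) (a : ℝ)
    (g gθ : 𝓢(EuclideanSpace ℝ (Fin 4), ℝ))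
    (hgθ : ∀ y : Site 4, gθ (a • siteToE y) = g (a • siteToE (y ∘ ⇑(Equiv.swap (0 : Fin 4) 1))))
    (w : Site 4) (U : ZdGaugeConfig 4 G) :
    smearedLatticeField r.curvature.F (box 4 L) a 1 0 g
        (fun e : Site 4 × Fin 4 => (ZdGaugeConfig.translate w U) (e.1 ∘ Equiv.swap (0 : Fin 4) 1,
          Equiv.swap (0 : Fin 4) 1 e.2)) =
      a ^ 4 * ∑ y ∈ box 4 L, gθ (a • siteToE y) *
        r.curvature.F (ZdGaugeConfig.translate (y + w) U) := by
  have hF : r.curvature.F = actionDensity r.ρ := rfl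
  rw [hF, SmearedCurvatureSwapCovariance r.ρ r.mem_unitary 0 1 L a 1 0 g gθ hgθ,
    SwapRP.smearedLatticeField_one_zero]
  simp only [configShift_neg_translate]

/-- First box limit: `⟨X ∘ τ_w⟩_Λ → a⁴ ∑ₓ g(a x) q = x̄`. [folklore] -/
theorem hasBoxLimit_smeared_translate (r : LatticeRep G) (β q : ℝ)
    (hq : ∀ x : Site 4, HasBoxLimit (fun Λ => zdExpect r.ρ β Λ
      (r.curvature.F ∘ ZdGaugeConfig.translate x)) q)
    (L : ℕ) (a : ℝ) (g : 𝓢(EuclideanSpace ℝ (Fin 4), ℝ)) (w : Site 4) :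
    HasBoxLimit (fun Λ => zdExpect r.ρ β Λ
      (smearedLatticeField r.curvature.F (box 4 L) a 1 0 g ∘ ZdGaugeConfig.translate w))
      (a ^ 4 * ∑ x ∈ box 4 L, g (a • siteToE x) * q) := by
  obtain ⟨C, hC⟩ := r.curvature.bounded
  have hX : smearedLatticeField r.curvature.F (box 4 L) a 1 0 g ∘ ZdGaugeConfig.translate w =
      fun U => a ^ 4 * ∑ x ∈ box 4 L, g (a • siteToE x) *
        (r.curvature.F ∘ ZdGaugeConfig.translate (x + w)) U := by
    funext U
    exact smeared_translate_apply r L a g w U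
  have hE := fun Λ : Finset (Site 4) => zdExpect_const_mul_sum r.ρ β Λ (box 4 L) (a ^ 4)
    (fun x => g (a • siteToE x)) (fun x => r.curvature.F ∘ ZdGaugeConfig.translate (x + w))
    (fun x => r.curvature.measurable.comp (measurable_translate' _)) (fun x => ⟨C, fun U => hC _⟩)
  unfold HasBoxLimit
  rw [hX]
  simp only [hE]
  exact (tendsto_finsetSum _ fun x _ => (hq (x + w)).const_mul _).const_mul _

/-- Second box limit: `⟨X ∘ Θ ∘ τ_w⟩_Λ → a⁴ ∑ₓ g(a x) q = x̄` (the swapped test function has the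
same box sum). [folklore] -/
theorem hasBoxLimit_smeared_swap_translate (r : LatticeRep G) (β q : ℝ)
    (hq : ∀ x : Site 4, HasBoxLimit (fun Λ => zdExpect r.ρ β Λ
      (r.curvature.F ∘ ZdGaugeConfig.translate x)) q)
    (L : ℕ) (a : ℝ) (g gθ : 𝓢(EuclideanSpace ℝ (Fin 4), ℝ))
    (hgθ : ∀ y : Site 4, gθ (a • siteToE y) = g (a • siteToE (y ∘ ⇑(Equiv.swap (0 : Fin 4) 1))))
    (w : Site 4) :
    HasBoxLimit (fun Λ => zdExpect r.ρ β Λ (fun U =>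
      smearedLatticeField r.curvature.F (box 4 L) a 1 0 g
        (fun e : Site 4 × Fin 4 => (ZdGaugeConfig.translate w U) (e.1 ∘ Equiv.swap (0 : Fin 4) 1,
          Equiv.swap (0 : Fin 4) 1 e.2))))
      (a ^ 4 * ∑ x ∈ box 4 L, g (a • siteToE x) * q) := by
  have hF : r.curvature.F = actionDensity r.ρ := rfl
  have hX : (fun U : ZdGaugeConfig 4 G => smearedLatticeField r.curvature.F (box 4 L) a 1 0 g
      (fun e : Site 4 × Fin 4 => (ZdGaugeConfig.translate w U) (e.1 ∘ Equiv.swap (0 : Fin 4) 1,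
        Equiv.swap (0 : Fin 4) 1 e.2))) =
      smearedLatticeField r.curvature.F (box 4 L) a 1 0 gθ ∘ ZdGaugeConfig.translate w := by
    funext U
    rw [Function.comp_apply, hF]
    exact SmearedCurvatureSwapCovariance r.ρ r.mem_unitary 0 1 L a 1 0 g gθ hgθ _
  have hsum : ∑ x ∈ box 4 L, gθ (a • siteToE x) * q = ∑ x ∈ box 4 L, g (a • siteToE x) * q := by
    simp only [hgθ]
    exact sum_box_comp_swap 0 1 L (fun y => g (a • siteToE y) * q)
  rw [hX, ← hsum]
  exact hasBoxLimit_smeared_translate r β q hq L a gθ w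

/-- Third box limit: `⟨(X ∘ τ_w) · (X ∘ Θ ∘ τ_{w'})⟩_Λ → a⁸ ∑_{x,y} g(a x) gθ(a y) P((y + w') - (x + w))`. [folklore] -/
theorem hasBoxLimit_smeared_pair (r : LatticeRep G) (β : ℝ) (P : Site 4 → ℝ)
    (hP : ∀ x y : Site 4, HasBoxLimit (fun Λ => zdExpect r.ρ β Λ (fun U =>
      r.curvature.F (ZdGaugeConfig.translate x U) * r.curvature.F (ZdGaugeConfig.translate y U)))
      (P (y - x)))
    (L : ℕ) (a : ℝ) (g gθ : 𝓢(EuclideanSpace ℝ (Fin 4), ℝ))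
    (hgθ : ∀ y : Site 4, gθ (a • siteToE y) = g (a • siteToE (y ∘ ⇑(Equiv.swap (0 : Fin 4) 1))))
    (w w' : Site 4) :
    HasBoxLimit (fun Λ => zdExpect r.ρ β Λ (fun U =>
      smearedLatticeField r.curvature.F (box 4 L) a 1 0 g (ZdGaugeConfig.translate w U) *
      smearedLatticeField r.curvature.F (box 4 L) a 1 0 g
        (fun e : Site 4 × Fin 4 => (ZdGaugeConfig.translate w' U) (e.1 ∘ Equiv.swap (0 : Fin 4) 1,
          Equiv.swap (0 : Fin 4) 1 e.2))))
      (a ^ 8 * ∑ x ∈ box 4 L, ∑ y ∈ box 4 L, g (a • siteToE x) * gθ (a • siteToE y) *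
        P (y + w' - (x + w))) := by
  obtain ⟨C, hC⟩ := r.curvature.bounded
  have hX : (fun U : ZdGaugeConfig 4 G =>
      smearedLatticeField r.curvature.F (box 4 L) a 1 0 g (ZdGaugeConfig.translate w U) *
      smearedLatticeField r.curvature.F (box 4 L) a 1 0 g
        (fun e : Site 4 × Fin 4 => (ZdGaugeConfig.translate w' U) (e.1 ∘ Equiv.swap (0 : Fin 4) 1,
          Equiv.swap (0 : Fin 4) 1 e.2))) =
      fun U => a ^ 8 * ∑ x ∈ box 4 L, ∑ y ∈ box 4 L, (g (a • siteToE x) * gθ (a • siteToE y)) *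
        (r.curvature.F (ZdGaugeConfig.translate (x + w) U) *
          r.curvature.F (ZdGaugeConfig.translate (y + w') U)) := by
    funext U
    rw [smeared_translate_apply, smeared_swap_translate_apply r L a g gθ hgθ, mul_mul_mul_comm,
      Finset.sum_mul_sum, show a ^ 4 * a ^ 4 = a ^ 8 by ring]
    congr 1
    exact Finset.sum_congr rfl fun x _ => Finset.sum_congr rfl fun y _ => by ring
  have hE := fun Λ : Finset (Site 4) => zdExpect_const_mul_sum₂ r.ρ β Λ (box 4 L) (box 4 L) (a ^ 8)
    (fun x y => g (a • siteToE x) * gθ (a • siteToE y))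
    (fun x y U => r.curvature.F (ZdGaugeConfig.translate (x + w) U) *
      r.curvature.F (ZdGaugeConfig.translate (y + w') U))
    (fun x y => (r.curvature.measurable.comp (measurable_translate' _)).mul
      (r.curvature.measurable.comp (measurable_translate' _)))
    (fun x y => ⟨C * C, fun U => by
      rw [abs_mul]
      exact mul_le_mul (hC _) (hC _) (abs_nonneg _) ((abs_nonneg _).trans (hC U))⟩)
  unfold HasBoxLimit
  rw [hX]
  simp only [hE]
  refine (tendsto_finsetSum _ fun x _ => tendsto_finsetSum _ fun y _ => ?_).const_mul _
  have h := hP (x + w) (y + w')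
  exact h.const_mul _

end Limits

/-- Centring: `a⁸ ∑ g gθ (P - q²) = a⁸ ∑ g gθ P - x̄²` with `x̄ = a⁴ ∑ g q`, because the swapped
test function has the same box sum. [folklore] -/
theorem centred_sum_eq (a q : ℝ) (L : ℕ) (g gθ : 𝓢(EuclideanSpace ℝ (Fin 4), ℝ))
    (hgθ : ∀ y : Site 4, gθ (a • siteToE y) = g (a • siteToE (y ∘ ⇑(Equiv.swap (0 : Fin 4) 1))))
    (Pz : Site 4 → Site 4 → ℝ) :
    a ^ 8 * ∑ x ∈ box 4 L, ∑ y ∈ box 4 L, g (a • siteToE x) * gθ (a • siteToE y) * (Pz x y - q ^ 2) =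
      a ^ 8 * ∑ x ∈ box 4 L, ∑ y ∈ box 4 L, g (a • siteToE x) * gθ (a • siteToE y) * Pz x y -
        (a ^ 4 * ∑ x ∈ box 4 L, g (a • siteToE x) * q) ^ 2 := by
  have hS : ∑ y ∈ box 4 L, gθ (a • siteToE y) * q = ∑ x ∈ box 4 L, g (a • siteToE x) * q := by
    simp only [hgθ]
    exact sum_box_comp_swap 0 1 L (fun y => g (a • siteToE y) * q)
  have h2 : (a ^ 4 * ∑ x ∈ box 4 L, g (a • siteToE x) * q) ^ 2 =
      a ^ 8 * ∑ x ∈ box 4 L, ∑ y ∈ box 4 L, g (a • siteToE x) * gθ (a • siteToE y) * q ^ 2 := by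
    calc (a ^ 4 * ∑ x ∈ box 4 L, g (a • siteToE x) * q) ^ 2
        = a ^ 8 * ((∑ x ∈ box 4 L, g (a • siteToE x) * q) *
            (∑ y ∈ box 4 L, gθ (a • siteToE y) * q)) := by rw [hS]; ring
      _ = _ := by
        rw [Finset.sum_mul_sum]
        congr 1
        exact Finset.sum_congr rfl fun x _ => Finset.sum_congr rfl fun y _ => by ring
  rw [h2, ← mul_sub, ← Finset.sum_sub_distrib]
  congr 1
  refine Finset.sum_congr rfl fun x _ => ?_
  rw [← Finset.sum_sub_distrib]
  exact Finset.sum_congr rfl fun y _ => by ring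

/-- The far bound from exponential clustering: `E U ≤ a⁸ (∑ |g||gθ|) A e^{2mL} · e^{-2mU}` for every
`U`, since `‖y - x - 2U v‖_∞ ≥ 2U - 2L` on the box. [folklore] -/
theorem centred_sum_far_bound (a q A m : ℝ) (ha : 0 < a) (hm : 0 < m) (hA : 0 ≤ A) (L : ℕ)
    (g gθ : 𝓢(EuclideanSpace ℝ (Fin 4), ℝ)) (Pβ : Site 4 → ℝ)
    (hclust : ∀ z : Site 4, |Pβ z - q ^ 2| ≤ A * Real.exp (-(m * ‖z‖))) (U : ℕ) :
    a ^ 8 * ∑ x ∈ box 4 L, ∑ y ∈ box 4 L, g (a • siteToE x) * gθ (a • siteToE y) *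
        (Pβ (y - x - ((2 * U : ℕ) : ℤ) • (Pi.single 0 (1 : ℤ) - Pi.single 1 (1 : ℤ) : Site 4)) - q ^ 2) ≤
      (a ^ 8 * (∑ x ∈ box 4 L, ∑ y ∈ box 4 L, |g (a • siteToE x)| * |gθ (a • siteToE y)|) *
        (A * Real.exp (2 * m * L))) * Real.exp (-(2 * m * U)) := by
  have hterm : ∀ x ∈ box 4 L, ∀ y ∈ box 4 L,
      |g (a • siteToE x) * gθ (a • siteToE y) *
        (Pβ (y - x - ((2 * U : ℕ) : ℤ) • (Pi.single 0 (1 : ℤ) - Pi.single 1 (1 : ℤ) : Site 4)) - q ^ 2)| ≤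
      |g (a • siteToE x)| * |gθ (a • siteToE y)| *
        (A * (Real.exp (2 * m * L) * Real.exp (-(2 * m * U)))) := by
    intro x hx y hy
    rw [abs_mul, abs_mul]
    refine mul_le_mul_of_nonneg_left ?_ (mul_nonneg (abs_nonneg _) (abs_nonneg _))
    calc _ ≤ A * Real.exp (-(m * ‖y - x - ((2 * U : ℕ) : ℤ) •
          (Pi.single 0 (1 : ℤ) - Pi.single 1 (1 : ℤ) : Site 4)‖)) := hclust _
      _ ≤ A * Real.exp (-(m * ((2 * U : ℝ) - 2 * L))) := by
        refine mul_le_mul_of_nonneg_left (Real.exp_le_exp.2 ?_) hA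
        have := norm_far_bound L U hx hy
        nlinarith
      _ = A * (Real.exp (2 * m * L) * Real.exp (-(2 * m * U))) := by
        rw [← Real.exp_add]
        congr 1
        ring
  calc _ ≤ |a ^ 8 * ∑ x ∈ box 4 L, ∑ y ∈ box 4 L, g (a • siteToE x) * gθ (a • siteToE y) *
        (Pβ (y - x - ((2 * U : ℕ) : ℤ) • (Pi.single 0 (1 : ℤ) - Pi.single 1 (1 : ℤ) : Site 4)) -
          q ^ 2)| := le_abs_self _
    _ = a ^ 8 * |∑ x ∈ box 4 L, ∑ y ∈ box 4 L, g (a • siteToE x) * gθ (a • siteToE y) *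
        (Pβ (y - x - ((2 * U : ℕ) : ℤ) • (Pi.single 0 (1 : ℤ) - Pi.single 1 (1 : ℤ) : Site 4)) -
          q ^ 2)| := by rw [abs_mul, abs_of_pos (pow_pos ha 8)]
    _ ≤ a ^ 8 * ∑ x ∈ box 4 L, ∑ y ∈ box 4 L, |g (a • siteToE x)| * |gθ (a • siteToE y)| *
        (A * (Real.exp (2 * m * L) * Real.exp (-(2 * m * U)))) :=
      mul_le_mul_of_nonneg_left ((Finset.abs_sum_le_sum_abs _ _).trans (Finset.sum_le_sum
        fun x hx => (Finset.abs_sum_le_sum_abs _ _).trans (Finset.sum_le_sum fun y hy =>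
          hterm x hx y hy))) (pow_pos ha 8).le
    _ = _ := by
      simp only [← Finset.sum_mul]
      ring

end SwapDecay

open SwapDecay in
/-- **Exponential decay of the swap-Hankel sequence of the smeared curvature.** At a fixed lattice
(spacing `a > 0`, box `{-L,…,L}⁴`, coupling `0 ≤ β ≤ β' < β₁/4`), given the infinite-volume one- and
two-point data `q β`, `P β` of the curvature with exponential clustering (hypothesis; the conclusion
of `InfiniteVolumeCurvatureClustering`), a test function `g` supported in `{z₀ - z₁ ≥ δ}`, `a ≤ δ`,
and its mirror image `gθ = g ∘ swap 0 1`, the centred swap-Hankel sequence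
`E u = a⁸ ∑_{x,y} g(a x) gθ(a y) (P β (y - x - 2u (e₀ - e₁)) - q β²)` is non-negative and
`E u ≤ E 0 · e^{-2mu}` for every `u` (reflection positivity ⇒ log-convexity, clustering ⇒ far decay,
`LogConvexExpDecay`) (REGISTERED signature — do not change). [folklore] -/
theorem SwapHankelDecay : ∀ (G : Type) [Group G] [TopologicalSpace G] [IsTopologicalGroup G] [CompactSpace G] [T2Space G] [SecondCountableTopology G] [MeasurableSpace G] [BorelSpace G] (r : Literature.MathematicalPhysics.QuantumFieldTheory.LatticeRep G) (β' m A : ℝ) (q : ℝ → ℝ) (P : ℝ → Literature.Probability.LatticeModels.Site 4 → ℝ), 0 < β' → β' < betaOne 4 r.ρ / 4 → 0 < m → (∀ β : ℝ, 0 ≤ β → β ≤ β' → (∀ x : Literature.Probability.LatticeModels.Site 4, Literature.Probability.LatticeModels.HasBoxLimit (fun Λ => Literature.MathematicalPhysics.QuantumFieldTheory.zdExpect r.ρ β Λ (r.curvature.F ∘ Literature.MathematicalPhysics.QuantumFieldTheory.ZdGaugeConfig.translate x)) (q β)) ∧ (∀ x y : Literature.Probability.LatticeModels.Site 4, Literature.Probability.LatticeModels.HasBoxLimit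 (fun Λ => Literature.MathematicalPhysics.QuantumFieldTheory.zdExpect r.ρ β Λ (fun U => r.curvature.F (Literature.MathematicalPhysics.QuantumFieldTheory.ZdGaugeConfig.translate x U) * r.curvature.F (Literature.MathematicalPhysics.QuantumFieldTheory.ZdGaugeConfig.translate y U))) (P β (y - x))) ∧ ∀ z : Literature.Probability.LatticeModels.Site 4, |P β z - q β ^ 2| ≤ A * Real.exp (-(m * ‖z‖))) → ∀ (β : ℝ), 0 ≤ β → β ≤ β' → ∀ (L : ℕ) (a δ : ℝ), 0 < a → a ≤ δ → ∀ (g gθ : SchwartzMap (EuclideanSpace ℝ (Fin 4)) ℝ), (∀ z ∈ tsupport (g : EuclideanSpace ℝ (Fin 4) → ℝ), δ ≤ z 0 - z 1) → (∀ z : EuclideanSpace ℝ (Fin 4), gθ z = g (WithLp.toLp 2 (fun i => z (Equiv.swap (0 : Fin 4) 1 i)))) → ∀ u : ℕ, 0 ≤ a ^ 8 * ∑ x ∈ Literature.Probability.LatticeModels.box 4 L, ∑ y ∈ Literature.Probability.LatticeModels.box 4 L, g (a • Literature.MathematicalPhysics.QuantumLattice.siteToE x) * gθ (a • Literature.MathematicalPhysics.QuantumLattice.siteToE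 y) * (P β (y - x - ((2 * u : ℕ) : ℤ) • (Pi.single 0 (1 : ℤ) - Pi.single 1 (1 : ℤ) : Literature.Probability.LatticeModels.Site 4)) - q β ^ 2) ∧ a ^ 8 * ∑ x ∈ Literature.Probability.LatticeModels.box 4 L, ∑ y ∈ Literature.Probability.LatticeModels.box 4 L, g (a • Literature.MathematicalPhysics.QuantumLattice.siteToE x) * gθ (a • Literature.MathematicalPhysics.QuantumLattice.siteToE y) * (P β (y - x - ((2 * u : ℕ) : ℤ) • (Pi.single 0 (1 : ℤ) - Pi.single 1 (1 : ℤ) : Literature.Probability.LatticeModels.Site 4)) - q β ^ 2) ≤ (a ^ 8 * ∑ x ∈ Literature.Probability.LatticeModels.box 4 L, ∑ y ∈ Literature.Probability.LatticeModels.box 4 L, g (a • Literature.MathematicalPhysics.QuantumLattice.siteToE x) * gθ (a • Literature.MathematicalPhysics.QuantumLattice.siteToE y) * (P β (y - x) - q β ^ 2)) * Real.exp (-(2 * m * u)) := by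
  intro G _ _ _ _ _ _ _ _ r β' m A q P _ _ hm hF5 β hβ0 hββ' L a δ ha haδ g gθ hg hgθ
  obtain ⟨hq, hP, hclust⟩ := hF5 β hβ0 hββ'
  have hgθ' : ∀ y : Site 4, gθ (a • siteToE y) = g (a • siteToE (y ∘ ⇑(Equiv.swap (0 : Fin 4) 1))) :=
    swapTest_apply_smul_siteToE a g gθ hgθ
  have hA : 0 ≤ A :=
    nonneg_of_mul_nonneg_left ((abs_nonneg _).trans (hclust 0)) (Real.exp_pos _)
  -- the data fed into `SwapHankelLogConvex`
  have hRP := SwapReflectionPositivity r.ρ r.continuous r.mem_unitary (0 : Fin 4) 1 (by decide) β hβ0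
  obtain ⟨⟨BX, hBX, hXdep⟩, hXm, hXbd⟩ :=
    SmearedPositiveHalfSupport r (0 : Fin 4) 1 (by decide) L a δ ha haδ g hg
  obtain ⟨CQ, hCQ⟩ := r.curvature.bounded
  obtain ⟨PX, hPX⟩ : ∃ PX : ℕ → ℝ, ∀ t, PX t = a ^ 8 * ∑ x ∈ box 4 L, ∑ y ∈ box 4 L,
      g (a • siteToE x) * gθ (a • siteToE y) *
        P β (y - x - (t : ℤ) • (Pi.single 0 (1 : ℤ) - Pi.single 1 (1 : ℤ) : Site 4)) :=
    ⟨_, fun _ => rfl⟩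
  have key := SwapHankelLogConvex r.N G r.ρ 0 1 β hRP
    (smearedLatticeField r.curvature.F (box 4 L) a 1 0 g) hXm ⟨_, hXbd CQ hCQ⟩ BX hXdep hBX
    (a ^ 4 * ∑ x ∈ box 4 L, g (a • siteToE x) * q β) PX
    (fun n => hasBoxLimit_smeared_translate r β (q β) hq L a g _)
    (fun n => hasBoxLimit_smeared_swap_translate r β (q β) hq L a g gθ hgθ' _)
    (fun n n' => by
      have h := hasBoxLimit_smeared_pair r β (P β) (hP) L a g gθ hgθ'
        ((n : ℤ) • (Pi.single 0 (1 : ℤ) - Pi.single 1 (1 : ℤ) : Site 4))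
        (-((n' : ℤ) • (Pi.single 0 (1 : ℤ) - Pi.single 1 (1 : ℤ) : Site 4)))
      have hv : ∀ x y : Site 4, y + -((n' : ℤ) • (Pi.single 0 (1 : ℤ) - Pi.single 1 (1 : ℤ) : Site 4)) -
          (x + (n : ℤ) • (Pi.single 0 (1 : ℤ) - Pi.single 1 (1 : ℤ) : Site 4)) =
          y - x - ((n + n' : ℕ) : ℤ) • (Pi.single 0 (1 : ℤ) - Pi.single 1 (1 : ℤ) : Site 4) := by
        intro x y
        push_cast
        rw [add_smul]
        abel
      simp only [hv] at h
      rw [hPX]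
      exact h)
  obtain ⟨-, hnonneg, hlc⟩ := key
  -- centring identity `E u = PX (2u) - x̄²`
  have hE : ∀ u : ℕ, a ^ 8 * ∑ x ∈ box 4 L, ∑ y ∈ box 4 L, g (a • siteToE x) * gθ (a • siteToE y) *
      (P β (y - x - ((2 * u : ℕ) : ℤ) • (Pi.single 0 (1 : ℤ) - Pi.single 1 (1 : ℤ) : Site 4)) -
        q β ^ 2) = PX (2 * u) - (a ^ 4 * ∑ x ∈ box 4 L, g (a • siteToE x) * q β) ^ 2 := by
    intro u
    rw [hPX]
    exact centred_sum_eq a (q β) L g gθ hgθ' _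
  -- exponential decay from log-convexity and the far bound
  have hdecay := LogConvexExpDecay
    (fun u => PX (2 * u) - (a ^ 4 * ∑ x ∈ box 4 L, g (a • siteToE x) * q β) ^ 2)
    hnonneg hlc
    (a ^ 8 * (∑ x ∈ box 4 L, ∑ y ∈ box 4 L, |g (a • siteToE x)| * |gθ (a • siteToE y)|) *
      (A * Real.exp (2 * m * L))) (2 * m)
    (Frequently.of_forall fun U => by
      rw [← hE U]
      exact centred_sum_far_bound a (q β) A m ha hm hA L g gθ (P β) hclust U)
  intro u
  have h0 : a ^ 8 * ∑ x ∈ box 4 L, ∑ y ∈ box 4 L, g (a • siteToE x) * gθ (a • siteToE y) *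
      (P β (y - x) - q β ^ 2) = PX (2 * 0) - (a ^ 4 * ∑ x ∈ box 4 L, g (a • siteToE x) * q β) ^ 2 := by
    rw [← hE 0]
    simp
  rw [hE u, h0]
  exact ⟨hnonneg u, hdecay u⟩

end Summit.QuantumFields.YangMills.Theorems.CurvatureKernel

end
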